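import Summits.QuantumFields.YangMills.Theorems.BackwardLiouvilleRigidityOneStepBackwardContractionAdmDescentDisintegration
import HarnessLib

/-!
# Crux `FluctuationComparisonRegPrIntL` (stmt-QuantumFields-20520) — LINE g26-2 «jensen_cumulant» v1 (ideator ym-r3-idea-1 g26, LENS «control»)

ROW CUT: JEN∘ `JensenGapCan` of LINE g25-1 «organ_tangent» (v2.6) — the quadratic Jensen gap of the cut flow,
`g_j(V) := h_j(V) − m(V) = log E′_{χ,V}[e^{h_{j+1}}] − E′_{χ,V}[h_{j+1}]` (the fibre CUMULANT GENERATING FUNCTION of the discrepancy at `t = 1`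
minus its first cumulant), presented with NO marginal part and 4-point weight `w′`, `Θ_j w′ ≤ C·x² + δ_j`.  JEN∘ is NOT under the FL-17 embargo
(critic idea-crit-5 #542 (R2): same height, quadratic currency — a volume-uniform constant is absorbed by `C`).

THE CUT (second-order truncation of the cumulant series — the one natural place to cut a cumulant generating function):
`g = q + (g − q)`, `q(V) := ½·Var′_{χ,V}[h_{j+1}] = ½·(E′_{χ,V}[h²] − m(V)²)`.
* VAR∘ `FibreVarianceCan` (M–L): the HALF CONDITIONAL χ-VARIANCE `q` is presented within `C·x² + δ_j` — a statement about the COVARIANCE of the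
  REFERENCE fibre measure `χρ′_{j+1}dσ_V` alone (one run, not two): `Δ_BΔ_{B′}q` is a sum of conditional covariances of the local pieces of `h`
  localised near `B` and `B′`, so the row is «exponential clustering of the reference fibre measure on the window × the presentation of `h`».
  Tools: Brascamp–Lieb ∕ fibre log-concavity from a height (the tree's fibre-convexity gap `c·β∕L²`, 23158's `FibreHessianGapAt` circle), or a
  single-measure cluster expansion (Bałaban's (R)-step propagator bounds [Balaban1985Propagators]); FL-17 column 1 measured the reference response decay
  `κ*_∞ = 1.224` per coarse unit — the ceiling for this row's `κ₀`, consistent with the κ-CEILING organ.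
* LME3∘ `CumulantRemainderCan` (M): the CUMULANT TAIL `g − q = Σ_{n≥3} κ_n(h | V)∕n!` is presented within `C·x² + δ_j` (in truth `O(x³)`): tree-graph
  (Brydges–Kennedy ∕ BKAR) bounds for `log E e^{h}` with `h` a sum of clustered local terms of size `x` — the textbook convergence of the cumulant
  expansion at small `x`, on the window, floor `δ_j` from the cutoff's edge and the large-field tails.
JUNCTIONS (kernel-checked, no sorry): ★C1 `jensenGap_of_cumulantCut : VAR∘ → LME3∘ → JEN∘` (presentation ADDITION: `w′ := w′_q + w′_r`, `C := C₁ + C₂`,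
`δ := δ₁ + δ₂`, ceilings by `min`, thresholds by `max`; the 4-point second difference is linear and `|·|` subadditive); ★C2
`oneStepContractionRun_of_cumulantCut : VER∘ → LIN∘ → VAR∘ → LME3∘ → O1` := ★ ∘ ★C1, with ★ = organ_tangent's `oneStepContractionRun_of_tangentCut`
re-proved here verbatim (rows restated BY TEXT; the crux directory is not importable).

C0 (planner's critic): Reduction 4 (each row strictly weaker than JEN∘: VAR∘ says nothing about cumulants ≥ 3, LME3∘ nothing about the variance; neither
implies O1, the crux or the leaf — BC2 must-fail file); Attack 4 (VAR∘: Brascamp–Lieb on the window from the fibre-convexity height + clustering of the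
reference fibre covariance; LME3∘: BKAR tree bound; first lemma = the 4-point covariance formula for `Δ_BΔ_{B′}Var`); Lever 3 (cumulant truncation is
classical; new RELATIVE TO THE LISTED LINES: no line isolates a ONE-RUN covariance statement — every other row compares two runs); Barriers 4 (same
placement as JEN∘: BalabanLargeField — window-local with floor `δ_j`; OS — not touched; FL-17 — same-height, quadratic currency, not in the embargoed
class); Killable 4 (VAR∘ dies if the reference fibre covariance on the window fails to cluster at some height ≥ j₁ — FL-17 column 1 says it clusters
at rate 1.224 in the linearised model; LME3∘ dies if the cumulant series of a clustered local `h` of size `x ≤ w₀` fails to converge — textbook says no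
for `w₀` small).  Predicted tier B.

HONEST FRAMING.  Rows are `Prop`s about the runs' towers; VAR∘∕LME3∘ are NOT proved here (2 sorries, in `stub_*` only); JEN∘, O1, the S-rows, the
crux 20520 and the leaf `YM3TorusSU2` are NOT proved; nothing of Bałaban's is asserted; LIN∘ (a hypothesis of ★C2) is under re-typing (FL-17) and this
line does not touch it; R3 = SU(2) YM₃ on T³ — NOT d = 4, NOT infinite volume, NOT a mass gap, NOT Clay; no summit is proved by a line.
-/

set_option autoImplicit false

open MeasureTheory Filter Topology
open Literature.MathematicalPhysics.QuantumFieldTheory.Balaban1983to89 T3ContinuumYM3Torus T3NestedUnitLaws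
  T3UnitLawDensityEML T4Continuum BalabanUVClass T3UnitScaleTilt

namespace Summit.QuantumFields.YangMills.Cruxes.FluctuationComparisonRegPrIntL.JensenCumulant


/-- The CONTINUOUS SMALL-FIELD CUTOFF `sfCut` — R-CUT-χ token of record (LEAD w3 g23 WORD №1 (iii) ∕ ideator №3; support `{∀ p, dist1 ≤ (24∕25)θ}` compact inside the open
window, `= 1` on `{∀ p, dist1 ≤ θ∕2}`), restated BY TEXT, byte-identical with `OrganTangent.sfCut` v2.6 and `RunPairOrgan.sfCut` v17.2. -/
noncomputable def sfCut {P : Params} {k : ℕ} (θ : ℝ) (U : GaugeField P k ↥(Matrix.specialUnitaryGroup (Fin 2) ℂ)) : ℝ :=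
  ∏ p : Plaq P k, max 0 (min 1 ((24 / 25 * θ - dist1 (GaugeField.plaqHol U p)) / ((24 / 25 - 1 / 2) * θ)))

/-- O1 · the one-step organ, restated BY TEXT (byte-identical with `RunPairOrgan.OneStepContractionRun` v17.2 and `OrganTangent.OneStepContractionRun` v2.6).
FL-17 NOTE: O1's single-step SUP remainder clause is UNDER RE-TYPING (critic #542; `CURRENCY-MEMO-g26.md`); ★C2 below is an implication and stays valid. -/
def OneStepContractionRun : Prop :=
  ∃ γ₁ : ℝ, 0 < γ₁ ∧ ∀ (F : T3Family) (γ : ℝ), 0 < γ → γ ≤ γ₁ → ∀ (b₀ p₀ : ℝ) (j₀ : ℕ) (prm : ℕ → ClassParams) (η : ℕ → ℝ), 0 < b₀ → 0 < p₀ → AdmissibleClassParams F γ b₀ p₀ prm → (∀ j, 0 ≤ η j) → Summable η → Summable (fun i => ∑' k, η (k + i)) → Tendsto (fun j => (∑' k, η (k + j)) * ((1 + 2 * ((F.L : ℝ) ^ j / γ) * (Fintype.card (Plaq (F.P j) 0) : ℝ)) * (Fintype.card (PBond (F.P j) 0) : ℝ) ^ 2)) atTop (𝓝 0) → ∃ κ₀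 : ℝ, 0 < κ₀ ∧ ∀ (κ : ℝ), 0 < κ → κ ≤ κ₀ → ∃ (θ C w₀ : ℝ) (ε εd δ : ℕ → ℝ) (j₁ : ℕ), 0 < θ ∧ 0 ≤ C ∧ 0 < w₀ ∧ (∀ j, 0 ≤ ε j ∧ 0 ≤ εd j ∧ 0 ≤ δ j) ∧ Summable ε ∧ Summable εd ∧ Summable δ ∧ Summable (fun i => ∑' k, δ (k + i)) ∧ Tendsto (fun j => (∑' k, δ (k + j)) * ((1 + 2 * ((F.L : ℝ) ^ j / γ) * (Fintype.card (Plaq (F.P j) 0) : ℝ)) * (Fintype.card (PBond (F.P j) 0) : ℝ) ^ 2)) atTop (𝓝 0) ∧ j₀ ≤ j₁ ∧ ∀ (ν : ℕ → (j : ℕ) → MeasureTheory.Measure (GaugeField (F.P j) 0 ↥(Matrix.specialUnitaryGroup (Fin 2) ℂ))), (∀ K, ν K K = T4GenFunBounds.gibbsMeasure (F.P K) ((F.scheme ℰp γ).β K)) → (∀ K j, j < K → ν K j = Measure.map (descend F ℰp j) (ν K (j + 1))) → ∀ (K K' : ℕ), K ≤ K' → ∀ (Ts T : ℕ), Ts <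 T → T ≤ K → ∀ (μ μ' : ((j : ℕ) → MeasureTheory.Measure (GaugeField (F.P j) 0 ↥(Matrix.specialUnitaryGroup (Fin 2) ℂ)))) (ρ ρ' : ((j : ℕ) → GaugeField (F.P j) 0 ↥(Matrix.specialUnitaryGroup (Fin 2) ℂ) → ℝ)), (∀ j : ℕ, Ts ≤ j → j ≤ T → μ j = ν K j ∧ μ' j = ν K' j) → (∀ j : ℕ, j < Ts → μ j = Measure.map (descend F ℰp j) ((μ (j + 1)).withDensity (fun U => ENNReal.ofReal (sfCut (θBal F.L γ b₀ p₀ (j + 1)) U))) ∧ μ' j = Measure.map (descend F ℰp j) ((μ' (j + 1)).withDensity (fun U => ENNReal.ofReal (sfCut (θBal F.L γ b₀ p₀ (j + 1)) U)))) → (∀ j : ℕ, Ts ≤ j → j < T → μ j = Measure.map (descend F ℰp j) (μ (j + 1)) ∧ μ' j = Measure.map (descend F ℰp j) (μ' (j + 1))) → (∀ j : ℕ, j ≤ T → IsFiniteMeasure (μ j) ∧ IsFiniteMeasure (μ' j)) → (∀ j : ℕ, j₀ ≤ j → j ≤ T → ((∀ U, PlaqSmall (θBal F.L γ b₀ p₀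 j) U → 0 < ρ j U ∧ 0 < ρ' j U) ∧ μ j = (fieldMeasure _ _ _).withDensity (fun U => ENNReal.ofReal (ρ j U)) ∧ μ' j = (fieldMeasure _ _ _).withDensity (fun U => ENNReal.ofReal (ρ' j U)) ∧ (∃ κ : ℝ, MemAtHeight F ℰp j (prm j) (fun U => Real.exp κ * ρ j U)) ∧ (∃ κ : ℝ, MemAtHeight F ℰp j (prm j) (fun U => Real.exp κ * ρ' j U)) ∧ μ j {U | ¬ PlaqSmall (θBal F.L γ b₀ p₀ j) U} ≤ ENNReal.ofReal (η j) ∧ μ' j {U | ¬ PlaqSmall (θBal F.L γ b₀ p₀ j) U} ≤ ENNReal.ofReal (η j) ∧ (ContinuousOn (ρ j) {U | PlaqSmall (θBal F.L γ b₀ p₀ j) U} ∧ ContinuousOn (ρ' j) {U | PlaqSmall (θBal F.L γ b₀ p₀ j) U}))) → ∀ (j : ℕ), j₁ ≤ j → j + 2 ≤ T → j + 1 ≤ Ts → ∀ (c : Plaq (F.P (j + 1)) 0 → ℝ) (a w : ℝ), 0 ≤ a → 0 ≤ w → a + θ / (((F.L : ℝ) ^ (j + 1) / γ) * θBal F.L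 γ b₀ p₀ (j + 1) ^ 2) * w ≤ w₀ → ((∀ p, |c p| ≤ a) ∧ (∀ (b b' : PBond (F.P (j + 1)) 0) U V W Z, PlaqSmall (θBal F.L γ b₀ p₀ (j + 1)) U → PlaqSmall (θBal F.L γ b₀ p₀ (j + 1)) V → PlaqSmall (θBal F.L γ b₀ p₀ (j + 1)) W → PlaqSmall (θBal F.L γ b₀ p₀ (j + 1)) Z → (∀ e, e ≠ b → U e = V e) → (∀ e, e ≠ b' → U e = W e) → (∀ e, e ≠ b' → V e = Z e) → (∀ e, e ≠ b → W e = Z e) → |(Real.log (ρ (j + 1) U) - Real.log (ρ' (j + 1) U) - ((F.L : ℝ) ^ (j + 1) / γ) * ∑ p, c p * (1 - reTr (GaugeField.plaqHol U p))) - (Real.log (ρ (j + 1) V) - Real.log (ρ' (j + 1) V) - ((F.L : ℝ) ^ (j + 1) / γ) * ∑ p, c p * (1 - reTr (GaugeField.plaqHol V p))) - ((Real.log (ρ (j + 1) W) - Real.log (ρ' (j + 1) W) - ((F.L : ℝ) ^ (j + 1) / γ) * ∑ p, c p * (1 - reTr (GaugeField.plaqHol W p))) - (Real.log (ρ (j +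 1) Z) - Real.log (ρ' (j + 1) Z) - ((F.L : ℝ) ^ (j + 1) / γ) * ∑ p, c p * (1 - reTr (GaugeField.plaqHol Z p))))| ≤ w * Real.exp (-(κ * (b.src.tdist b'.src : ℝ))))) → ∃ (c' : Plaq (F.P j) 0 → ℝ) (a' w' : ℝ), 0 ≤ a' ∧ 0 ≤ w' ∧ a' + θ / (((F.L : ℝ) ^ j / γ) * θBal F.L γ b₀ p₀ j ^ 2) * w' ≤ (1 + ε j + εd (T - (j + 2)) + C * (a + θ / (((F.L : ℝ) ^ (j + 1) / γ) * θBal F.L γ b₀ p₀ (j + 1) ^ 2) * w)) * (a + θ / (((F.L : ℝ) ^ (j + 1) / γ) * θBal F.L γ b₀ p₀ (j + 1) ^ 2) * w) + δ j ∧ ((∀ p, |c' p| ≤ a') ∧ (∀ (b b' : PBond (F.P j) 0) U V W Z, PlaqSmall (θBal F.L γ b₀ p₀ j) U → PlaqSmall (θBal F.L γ b₀ p₀ j) V → PlaqSmall (θBal F.L γ b₀ p₀ j) W → PlaqSmall (θBal F.L γ b₀ p₀ j) Z → (∀ e, e ≠ b → U e = V e) → (∀ e, e ≠ b' → U e = W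 e) → (∀ e, e ≠ b' → V e = Z e) → (∀ e, e ≠ b → W e = Z e) → |(Real.log (ρ j U) - Real.log (ρ' j U) - ((F.L : ℝ) ^ j / γ) * ∑ p, c' p * (1 - reTr (GaugeField.plaqHol U p))) - (Real.log (ρ j V) - Real.log (ρ' j V) - ((F.L : ℝ) ^ j / γ) * ∑ p, c' p * (1 - reTr (GaugeField.plaqHol V p))) - ((Real.log (ρ j W) - Real.log (ρ' j W) - ((F.L : ℝ) ^ j / γ) * ∑ p, c' p * (1 - reTr (GaugeField.plaqHol W p))) - (Real.log (ρ j Z) - Real.log (ρ' j Z) - ((F.L : ℝ) ^ j / γ) * ∑ p, c' p * (1 - reTr (GaugeField.plaqHol Z p))))| ≤ w' * Real.exp (-(κ * (b.src.tdist b'.src : ℝ)))))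

/-- VER∘ (v2) · window-continuous version of the localised fibre mean, restated BY TEXT (byte-identical with `OrganTangent.FibreMeanVersionCan` v2.6;
its stub and its supplier line `version_coarea` live there). Hypothesis of ★C2 only. -/
def FibreMeanVersionCan : Prop :=
  ∀ (F : T3Family) (γ b₀ p₀ : ℝ), 0 < γ → γ ≤ 1 → 0 < b₀ → 0 < p₀ → ∃ jV : ℕ, ∀ (j₀ : ℕ) (prm : ℕ → ClassParams) (η : ℕ → ℝ), ∀ (ν : ℕ → (j : ℕ) → MeasureTheory.Measure (GaugeField (F.P j) 0 ↥(Matrix.specialUnitaryGroup (Fin 2) ℂ))), (∀ K, ν K K = T4GenFunBounds.gibbsMeasure (F.P K) ((F.scheme ℰp γ).β K)) → (∀ K j, j < K → ν K j = Measure.map (descend F ℰp j) (ν K (j + 1))) → ∀ (K K' : ℕ), K ≤ K' → ∀ (Ts T : ℕ), Ts < T → T ≤ K → ∀ (μ μ' : ((j : ℕ) → MeasureTheory.Measure (GaugeField (F.P j) 0 ↥(Matrix.specialUnitaryGroup (Fin 2) ℂ)))) (ρ ρ' : ((j : ℕ) → GaugeField (F.P j) 0 ↥(Matrix.specialUnitaryGroup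 (Fin 2) ℂ) → ℝ)), (∀ j : ℕ, Ts ≤ j → j ≤ T → μ j = ν K j ∧ μ' j = ν K' j) → (∀ j : ℕ, j < Ts → μ j = Measure.map (descend F ℰp j) ((μ (j + 1)).withDensity (fun U => ENNReal.ofReal (sfCut (θBal F.L γ b₀ p₀ (j + 1)) U))) ∧ μ' j = Measure.map (descend F ℰp j) ((μ' (j + 1)).withDensity (fun U => ENNReal.ofReal (sfCut (θBal F.L γ b₀ p₀ (j + 1)) U)))) → (∀ j : ℕ, Ts ≤ j → j < T → μ j = Measure.map (descend F ℰp j) (μ (j + 1)) ∧ μ' j = Measure.map (descend F ℰp j) (μ' (j + 1))) → (∀ j : ℕ, j ≤ T → IsFiniteMeasure (μ j) ∧ IsFiniteMeasure (μ' j)) → (∀ j : ℕ, j₀ ≤ j → j ≤ T → ((∀ U, PlaqSmall (θBal F.L γ b₀ p₀ j) U → 0 < ρ j U ∧ 0 < ρ' j U) ∧ μ j = (fieldMeasure _ _ _).withDensity (fun U => ENNReal.ofReal (ρ j U)) ∧ μ' j = (fieldMeasure _ _ _).withDensity (fun U => ENNReal.ofReal (ρ' j U)) ∧ (∃ κ :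 ℝ, MemAtHeight F ℰp j (prm j) (fun U => Real.exp κ * ρ j U)) ∧ (∃ κ : ℝ, MemAtHeight F ℰp j (prm j) (fun U => Real.exp κ * ρ' j U)) ∧ μ j {U | ¬ PlaqSmall (θBal F.L γ b₀ p₀ j) U} ≤ ENNReal.ofReal (η j) ∧ μ' j {U | ¬ PlaqSmall (θBal F.L γ b₀ p₀ j) U} ≤ ENNReal.ofReal (η j) ∧ (ContinuousOn (ρ j) {U | PlaqSmall (θBal F.L γ b₀ p₀ j) U} ∧ ContinuousOn (ρ' j) {U | PlaqSmall (θBal F.L γ b₀ p₀ j) U}))) → ∀ (j : ℕ), jV ≤ j → j₀ ≤ j → j + 1 ≤ T → ∀ (σ : ProbabilityTheory.Kernel (GaugeField (F.P j) 0 ↥(Matrix.specialUnitaryGroup (Fin 2) ℂ)) (GaugeField (F.P (j + 1)) 0 ↥(Matrix.specialUnitaryGroup (Fin 2) ℂ))), ProbabilityTheory.IsMarkovKernel σ → (Measure.map (descend F ℰp j) (fieldMeasure (F.P (j + 1)) 0 ↥(Matrix.specialUnitaryGroup (Fin 2) ℂ))).bind ⇑σ = fieldMeasure (F.P (j + 1))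 0 ↥(Matrix.specialUnitaryGroup (Fin 2) ℂ) → (∀ᵐ V ∂(Measure.map (descend F ℰp j) (fieldMeasure (F.P (j + 1)) 0 ↥(Matrix.specialUnitaryGroup (Fin 2) ℂ))), ∀ᵐ U ∂(σ V), descend F ℰp j U = V) → ∃ (m : GaugeField (F.P j) 0 ↥(Matrix.specialUnitaryGroup (Fin 2) ℂ) → ℝ), ContinuousOn m {V | PlaqSmall (θBal F.L γ b₀ p₀ j) V} ∧ (∀ᵐ V ∂(fieldMeasure (F.P j) 0 ↥(Matrix.specialUnitaryGroup (Fin 2) ℂ)), PlaqSmall (θBal F.L γ b₀ p₀ j) V → MeasureTheory.Integrable (fun U => sfCut (θBal F.L γ b₀ p₀ (j + 1)) U * (Real.log (ρ (j + 1) U) - Real.log (ρ' (j + 1) U)) * ρ' (j + 1) U) (σ V) ∧ m V = (∫ U, sfCut (θBal F.L γ b₀ p₀ (j + 1)) U * (Real.log (ρ (j + 1) U) - Real.log (ρ' (j + 1) U)) * ρ' (j + 1) U ∂(σ V)) / (∫ U, sfCut (θBal F.L γ b₀ p₀ (j + 1)) U * ρ' (j + 1) U ∂(σ V)))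

/-- LIN∘ · tangent transport, restated BY TEXT (byte-identical with `OrganTangent.TangentTransportCan` v2.6).  UNDER RE-TYPING (FL-17, critic #542 (R2):
EMBARGO-LITE).  Hypothesis of ★C2 only; this line does not touch it. -/
def TangentTransportCan : Prop :=
  ∃ γ₁ : ℝ, 0 < γ₁ ∧ ∀ (F : T3Family) (γ : ℝ), 0 < γ → γ ≤ γ₁ → ∀ (b₀ p₀ : ℝ) (j₀ : ℕ) (prm : ℕ → ClassParams) (η : ℕ → ℝ), 0 < b₀ → 0 < p₀ → AdmissibleClassParams F γ b₀ p₀ prm → (∀ j, 0 ≤ η j) → Summable η → Summable (fun i => ∑' k, η (k + i)) → Tendsto (fun j => (∑' k, η (k + j)) * ((1 + 2 * ((F.L : ℝ) ^ j / γ) * (Fintype.card (Plaq (F.P j) 0) : ℝ)) * (Fintype.card (PBond (F.P j) 0) : ℝ) ^ 2)) atTop (𝓝 0) → ∃ κ₀ : ℝ, 0 < κ₀ ∧ ∀ (κ : ℝ), 0 < κ → κ ≤ κ₀ → ∃ θ₀ : ℝ, 0 < θ₀ ∧ ∀ (θ : ℝ), 0 < θ → θ ≤ θ₀ → ∃ (w₀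 : ℝ) (ε εd δ : ℕ → ℝ) (j₁ : ℕ), 0 < w₀ ∧ (∀ j, 0 ≤ ε j ∧ 0 ≤ εd j ∧ 0 ≤ δ j) ∧ Summable ε ∧ Summable εd ∧ Summable δ ∧ Summable (fun i => ∑' k, δ (k + i)) ∧ Tendsto (fun j => (∑' k, δ (k + j)) * ((1 + 2 * ((F.L : ℝ) ^ j / γ) * (Fintype.card (Plaq (F.P j) 0) : ℝ)) * (Fintype.card (PBond (F.P j) 0) : ℝ) ^ 2)) atTop (𝓝 0) ∧ j₀ ≤ j₁ ∧ ∀ (ν : ℕ → (j : ℕ) → MeasureTheory.Measure (GaugeField (F.P j) 0 ↥(Matrix.specialUnitaryGroup (Fin 2) ℂ))), (∀ K, ν K K = T4GenFunBounds.gibbsMeasure (F.P K) ((F.scheme ℰp γ).β K)) → (∀ K j, j < K → ν K j = Measure.map (descend F ℰp j) (ν K (j + 1))) → ∀ (K K' : ℕ), K ≤ K' → ∀ (Ts T : ℕ), Ts < T → T ≤ K → ∀ (μ μ' : ((j : ℕ) → MeasureTheory.Measure (GaugeField (F.P j) 0 ↥(Matrix.specialUnitaryGroup (Fin 2) ℂ))))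 (ρ ρ' : ((j : ℕ) → GaugeField (F.P j) 0 ↥(Matrix.specialUnitaryGroup (Fin 2) ℂ) → ℝ)), (∀ j : ℕ, Ts ≤ j → j ≤ T → μ j = ν K j ∧ μ' j = ν K' j) → (∀ j : ℕ, j < Ts → μ j = Measure.map (descend F ℰp j) ((μ (j + 1)).withDensity (fun U => ENNReal.ofReal (sfCut (θBal F.L γ b₀ p₀ (j + 1)) U))) ∧ μ' j = Measure.map (descend F ℰp j) ((μ' (j + 1)).withDensity (fun U => ENNReal.ofReal (sfCut (θBal F.L γ b₀ p₀ (j + 1)) U)))) → (∀ j : ℕ, Ts ≤ j → j < T → μ j = Measure.map (descend F ℰp j) (μ (j + 1)) ∧ μ' j = Measure.map (descend F ℰp j) (μ' (j + 1))) → (∀ j : ℕ, j ≤ T → IsFiniteMeasure (μ j) ∧ IsFiniteMeasure (μ' j)) → (∀ j : ℕ, j₀ ≤ j → j ≤ T → ((∀ U, PlaqSmall (θBal F.L γ b₀ p₀ j) U → 0 < ρ j U ∧ 0 < ρ' j U) ∧ μ j = (fieldMeasure _ _ _).withDensity (fun U => ENNReal.ofReal (ρ j U)) ∧ μ' j = (fieldMeasure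 _ _ _).withDensity (fun U => ENNReal.ofReal (ρ' j U)) ∧ (∃ κ : ℝ, MemAtHeight F ℰp j (prm j) (fun U => Real.exp κ * ρ j U)) ∧ (∃ κ : ℝ, MemAtHeight F ℰp j (prm j) (fun U => Real.exp κ * ρ' j U)) ∧ μ j {U | ¬ PlaqSmall (θBal F.L γ b₀ p₀ j) U} ≤ ENNReal.ofReal (η j) ∧ μ' j {U | ¬ PlaqSmall (θBal F.L γ b₀ p₀ j) U} ≤ ENNReal.ofReal (η j) ∧ (ContinuousOn (ρ j) {U | PlaqSmall (θBal F.L γ b₀ p₀ j) U} ∧ ContinuousOn (ρ' j) {U | PlaqSmall (θBal F.L γ b₀ p₀ j) U}))) → ∀ (j : ℕ), j₁ ≤ j → j + 2 ≤ T → j + 1 ≤ Ts → ∀ (σ : ProbabilityTheory.Kernel (GaugeField (F.P j) 0 ↥(Matrix.specialUnitaryGroup (Fin 2) ℂ)) (GaugeField (F.P (j + 1)) 0 ↥(Matrix.specialUnitaryGroup (Fin 2) ℂ))), ProbabilityTheory.IsMarkovKernel σ → (Measure.map (descend F ℰp j) (fieldMeasure (F.P (j + 1)) 0 ↥(Matrix.specialUnitaryGroup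 (Fin 2) ℂ))).bind ⇑σ = fieldMeasure (F.P (j + 1)) 0 ↥(Matrix.specialUnitaryGroup (Fin 2) ℂ) → (∀ᵐ V ∂(Measure.map (descend F ℰp j) (fieldMeasure (F.P (j + 1)) 0 ↥(Matrix.specialUnitaryGroup (Fin 2) ℂ))), ∀ᵐ U ∂(σ V), descend F ℰp j U = V) → ∀ (m : GaugeField (F.P j) 0 ↥(Matrix.specialUnitaryGroup (Fin 2) ℂ) → ℝ), ContinuousOn m {V | PlaqSmall (θBal F.L γ b₀ p₀ j) V} → (∀ᵐ V ∂(fieldMeasure (F.P j) 0 ↥(Matrix.specialUnitaryGroup (Fin 2) ℂ)), PlaqSmall (θBal F.L γ b₀ p₀ j) V → MeasureTheory.Integrable (fun U => sfCut (θBal F.L γ b₀ p₀ (j + 1)) U * (Real.log (ρ (j + 1) U) - Real.log (ρ' (j + 1) U)) * ρ' (j + 1) U) (σ V) ∧ m V = (∫ U, sfCut (θBal F.L γ b₀ p₀ (j + 1)) U * (Real.log (ρ (j + 1) U) - Real.log (ρ' (j + 1) U)) * ρ' (j + 1) U ∂(σ V)) / (∫ U, sfCut (θBal F.L γ b₀ p₀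 (j + 1)) U * ρ' (j + 1) U ∂(σ V))) → ∀ (c : Plaq (F.P (j + 1)) 0 → ℝ) (a w : ℝ), 0 ≤ a → 0 ≤ w → a + θ / (((F.L : ℝ) ^ (j + 1) / γ) * θBal F.L γ b₀ p₀ (j + 1) ^ 2) * w ≤ w₀ → ((∀ p, |c p| ≤ a) ∧ (∀ (b b' : PBond (F.P (j + 1)) 0) U V W Z, PlaqSmall (θBal F.L γ b₀ p₀ (j + 1)) U → PlaqSmall (θBal F.L γ b₀ p₀ (j + 1)) V → PlaqSmall (θBal F.L γ b₀ p₀ (j + 1)) W → PlaqSmall (θBal F.L γ b₀ p₀ (j + 1)) Z → (∀ e, e ≠ b → U e = V e) → (∀ e, e ≠ b' → U e = W e) → (∀ e, e ≠ b' → V e = Z e) → (∀ e, e ≠ b → W e = Z e) → |(Real.log (ρ (j + 1) U) - Real.log (ρ' (j + 1) U) - ((F.L : ℝ) ^ (j + 1) / γ) * ∑ p, c p * (1 - reTr (GaugeField.plaqHol U p))) - (Real.log (ρ (j + 1) V) - Real.log (ρ' (j + 1) V) - ((F.L : ℝ) ^ (j + 1) / γ) * ∑ p, c p * (1 - reTr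 (GaugeField.plaqHol V p))) - ((Real.log (ρ (j + 1) W) - Real.log (ρ' (j + 1) W) - ((F.L : ℝ) ^ (j + 1) / γ) * ∑ p, c p * (1 - reTr (GaugeField.plaqHol W p))) - (Real.log (ρ (j + 1) Z) - Real.log (ρ' (j + 1) Z) - ((F.L : ℝ) ^ (j + 1) / γ) * ∑ p, c p * (1 - reTr (GaugeField.plaqHol Z p))))| ≤ w * Real.exp (-(κ * (b.src.tdist b'.src : ℝ))))) → ∃ (c' : Plaq (F.P j) 0 → ℝ) (a' w' : ℝ), 0 ≤ a' ∧ 0 ≤ w' ∧ a' + θ / (((F.L : ℝ) ^ j / γ) * θBal F.L γ b₀ p₀ j ^ 2) * w' ≤ (1 + ε j + εd (T - (j + 2))) * (a + θ / (((F.L : ℝ) ^ (j + 1) / γ) * θBal F.L γ b₀ p₀ (j + 1) ^ 2) * w) + δ j ∧ ((∀ p, |c' p| ≤ a') ∧ (∀ (b b' : PBond (F.P j) 0) U V W Z, PlaqSmall (θBal F.L γ b₀ p₀ j) U → PlaqSmall (θBal F.L γ b₀ p₀ j) V → PlaqSmall (θBal F.L γ b₀ p₀ j) W → PlaqSmall (θBal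 F.L γ b₀ p₀ j) Z → (∀ e, e ≠ b → U e = V e) → (∀ e, e ≠ b' → U e = W e) → (∀ e, e ≠ b' → V e = Z e) → (∀ e, e ≠ b → W e = Z e) → |(m U - ((F.L : ℝ) ^ j / γ) * ∑ p, c' p * (1 - reTr (GaugeField.plaqHol U p))) - (m V - ((F.L : ℝ) ^ j / γ) * ∑ p, c' p * (1 - reTr (GaugeField.plaqHol V p))) - ((m W - ((F.L : ℝ) ^ j / γ) * ∑ p, c' p * (1 - reTr (GaugeField.plaqHol W p))) - (m Z - ((F.L : ℝ) ^ j / γ) * ∑ p, c' p * (1 - reTr (GaugeField.plaqHol Z p))))| ≤ w' * Real.exp (-(κ * (b.src.tdist b'.src : ℝ)))))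

/-- JEN∘ · the quadratic Jensen gap, restated BY TEXT (byte-identical with `OrganTangent.JensenGapCan` v2.6) — the row CUT by this line:
DERIVED below from VAR∘ ∧ LME3∘ (`jensenGap_of_cumulantCut`), no stub here.  NOT under the FL-17 embargo (critic #542 (R2): same-height, quadratic currency). -/
def JensenGapCan : Prop :=
  ∃ γ₁ : ℝ, 0 < γ₁ ∧ ∀ (F : T3Family) (γ : ℝ), 0 < γ → γ ≤ γ₁ → ∀ (b₀ p₀ : ℝ) (j₀ : ℕ) (prm : ℕ → ClassParams) (η : ℕ → ℝ), 0 < b₀ → 0 < p₀ → AdmissibleClassParams F γ b₀ p₀ prm → (∀ j, 0 ≤ η j) → Summable η → Summable (fun i => ∑' k, η (k + i)) → Tendsto (fun j => (∑' k, η (k + j)) * ((1 + 2 * ((F.L : ℝ) ^ j / γ) * (Fintype.card (Plaq (F.P j) 0) : ℝ)) * (Fintype.card (PBond (F.P j) 0) : ℝ) ^ 2)) atTop (𝓝 0) → ∃ κ₀ : ℝ, 0 < κ₀ ∧ ∀ (κ : ℝ), 0 < κ → κ ≤ κ₀ → ∃ θ₀ : ℝ, 0 < θ₀ ∧ ∀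 (θ : ℝ), 0 < θ → θ ≤ θ₀ → ∃ (C w₀ : ℝ) (δ : ℕ → ℝ) (j₁ : ℕ), 0 ≤ C ∧ 0 < w₀ ∧ (∀ j, 0 ≤ δ j) ∧ Summable δ ∧ Summable (fun i => ∑' k, δ (k + i)) ∧ Tendsto (fun j => (∑' k, δ (k + j)) * ((1 + 2 * ((F.L : ℝ) ^ j / γ) * (Fintype.card (Plaq (F.P j) 0) : ℝ)) * (Fintype.card (PBond (F.P j) 0) : ℝ) ^ 2)) atTop (𝓝 0) ∧ j₀ ≤ j₁ ∧ ∀ (ν : ℕ → (j : ℕ) → MeasureTheory.Measure (GaugeField (F.P j) 0 ↥(Matrix.specialUnitaryGroup (Fin 2) ℂ))), (∀ K, ν K K = T4GenFunBounds.gibbsMeasure (F.P K) ((F.scheme ℰp γ).β K)) → (∀ K j, j < K → ν K j = Measure.map (descend F ℰp j) (ν K (j + 1))) → ∀ (K K' : ℕ), K ≤ K' → ∀ (Ts T : ℕ), Ts < T → T ≤ K → ∀ (μ μ' : ((j : ℕ) → MeasureTheory.Measure (GaugeField (F.P j) 0 ↥(Matrix.specialUnitaryGroup (Fin 2) ℂ))))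 (ρ ρ' : ((j : ℕ) → GaugeField (F.P j) 0 ↥(Matrix.specialUnitaryGroup (Fin 2) ℂ) → ℝ)), (∀ j : ℕ, Ts ≤ j → j ≤ T → μ j = ν K j ∧ μ' j = ν K' j) → (∀ j : ℕ, j < Ts → μ j = Measure.map (descend F ℰp j) ((μ (j + 1)).withDensity (fun U => ENNReal.ofReal (sfCut (θBal F.L γ b₀ p₀ (j + 1)) U))) ∧ μ' j = Measure.map (descend F ℰp j) ((μ' (j + 1)).withDensity (fun U => ENNReal.ofReal (sfCut (θBal F.L γ b₀ p₀ (j + 1)) U)))) → (∀ j : ℕ, Ts ≤ j → j < T → μ j = Measure.map (descend F ℰp j) (μ (j + 1)) ∧ μ' j = Measure.map (descend F ℰp j) (μ' (j + 1))) → (∀ j : ℕ, j ≤ T → IsFiniteMeasure (μ j) ∧ IsFiniteMeasure (μ' j)) → (∀ j : ℕ, j₀ ≤ j → j ≤ T → ((∀ U, PlaqSmall (θBal F.L γ b₀ p₀ j) U → 0 < ρ j U ∧ 0 < ρ' j U) ∧ μ j = (fieldMeasure _ _ _).withDensity (fun U => ENNReal.ofReal (ρ j U)) ∧ μ' j = (fieldMeasure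 _ _ _).withDensity (fun U => ENNReal.ofReal (ρ' j U)) ∧ (∃ κ : ℝ, MemAtHeight F ℰp j (prm j) (fun U => Real.exp κ * ρ j U)) ∧ (∃ κ : ℝ, MemAtHeight F ℰp j (prm j) (fun U => Real.exp κ * ρ' j U)) ∧ μ j {U | ¬ PlaqSmall (θBal F.L γ b₀ p₀ j) U} ≤ ENNReal.ofReal (η j) ∧ μ' j {U | ¬ PlaqSmall (θBal F.L γ b₀ p₀ j) U} ≤ ENNReal.ofReal (η j) ∧ (ContinuousOn (ρ j) {U | PlaqSmall (θBal F.L γ b₀ p₀ j) U} ∧ ContinuousOn (ρ' j) {U | PlaqSmall (θBal F.L γ b₀ p₀ j) U}))) → ∀ (j : ℕ), j₁ ≤ j → j + 2 ≤ T → j + 1 ≤ Ts → ∀ (σ : ProbabilityTheory.Kernel (GaugeField (F.P j) 0 ↥(Matrix.specialUnitaryGroup (Fin 2) ℂ)) (GaugeField (F.P (j + 1)) 0 ↥(Matrix.specialUnitaryGroup (Fin 2) ℂ))), ProbabilityTheory.IsMarkovKernel σ → (Measure.map (descend F ℰp j) (fieldMeasure (F.P (j + 1)) 0 ↥(Matrix.specialUnitaryGroup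 (Fin 2) ℂ))).bind ⇑σ = fieldMeasure (F.P (j + 1)) 0 ↥(Matrix.specialUnitaryGroup (Fin 2) ℂ) → (∀ᵐ V ∂(Measure.map (descend F ℰp j) (fieldMeasure (F.P (j + 1)) 0 ↥(Matrix.specialUnitaryGroup (Fin 2) ℂ))), ∀ᵐ U ∂(σ V), descend F ℰp j U = V) → ∀ (m : GaugeField (F.P j) 0 ↥(Matrix.specialUnitaryGroup (Fin 2) ℂ) → ℝ), ContinuousOn m {V | PlaqSmall (θBal F.L γ b₀ p₀ j) V} → (∀ᵐ V ∂(fieldMeasure (F.P j) 0 ↥(Matrix.specialUnitaryGroup (Fin 2) ℂ)), PlaqSmall (θBal F.L γ b₀ p₀ j) V → MeasureTheory.Integrable (fun U => sfCut (θBal F.L γ b₀ p₀ (j + 1)) U * (Real.log (ρ (j + 1) U) - Real.log (ρ' (j + 1) U)) * ρ' (j + 1) U) (σ V) ∧ m V = (∫ U, sfCut (θBal F.L γ b₀ p₀ (j + 1)) U * (Real.log (ρ (j + 1) U) - Real.log (ρ' (j + 1) U)) * ρ' (j + 1) U ∂(σ V)) / (∫ U, sfCut (θBal F.L γ b₀ p₀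 (j + 1)) U * ρ' (j + 1) U ∂(σ V))) → ∀ (c : Plaq (F.P (j + 1)) 0 → ℝ) (a w : ℝ), 0 ≤ a → 0 ≤ w → a + θ / (((F.L : ℝ) ^ (j + 1) / γ) * θBal F.L γ b₀ p₀ (j + 1) ^ 2) * w ≤ w₀ → ((∀ p, |c p| ≤ a) ∧ (∀ (b b' : PBond (F.P (j + 1)) 0) U V W Z, PlaqSmall (θBal F.L γ b₀ p₀ (j + 1)) U → PlaqSmall (θBal F.L γ b₀ p₀ (j + 1)) V → PlaqSmall (θBal F.L γ b₀ p₀ (j + 1)) W → PlaqSmall (θBal F.L γ b₀ p₀ (j + 1)) Z → (∀ e, e ≠ b → U e = V e) → (∀ e, e ≠ b' → U e = W e) → (∀ e, e ≠ b' → V e = Z e) → (∀ e, e ≠ b → W e = Z e) → |(Real.log (ρ (j + 1) U) - Real.log (ρ' (j + 1) U) - ((F.L : ℝ) ^ (j + 1) / γ) * ∑ p, c p * (1 - reTr (GaugeField.plaqHol U p))) - (Real.log (ρ (j + 1) V) - Real.log (ρ' (j + 1) V) - ((F.L : ℝ) ^ (j + 1) / γ) * ∑ p, c p * (1 - reTr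 (GaugeField.plaqHol V p))) - ((Real.log (ρ (j + 1) W) - Real.log (ρ' (j + 1) W) - ((F.L : ℝ) ^ (j + 1) / γ) * ∑ p, c p * (1 - reTr (GaugeField.plaqHol W p))) - (Real.log (ρ (j + 1) Z) - Real.log (ρ' (j + 1) Z) - ((F.L : ℝ) ^ (j + 1) / γ) * ∑ p, c p * (1 - reTr (GaugeField.plaqHol Z p))))| ≤ w * Real.exp (-(κ * (b.src.tdist b'.src : ℝ))))) → ∃ (w' : ℝ), 0 ≤ w' ∧ θ / (((F.L : ℝ) ^ j / γ) * θBal F.L γ b₀ p₀ j ^ 2) * w' ≤ C * (a + θ / (((F.L : ℝ) ^ (j + 1) / γ) * θBal F.L γ b₀ p₀ (j + 1) ^ 2) * w) * (a + θ / (((F.L : ℝ) ^ (j + 1) / γ) * θBal F.L γ b₀ p₀ (j + 1) ^ 2) * w) + δ j ∧ (∀ (b b' : PBond (F.P j) 0) U V W Z, PlaqSmall (θBal F.L γ b₀ p₀ j) U → PlaqSmall (θBal F.L γ b₀ p₀ j) V → PlaqSmall (θBal F.L γ b₀ p₀ j) W → PlaqSmall (θBal F.L γ b₀ p₀ j) Z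 → (∀ e, e ≠ b → U e = V e) → (∀ e, e ≠ b' → U e = W e) → (∀ e, e ≠ b' → V e = Z e) → (∀ e, e ≠ b → W e = Z e) → |(Real.log (ρ j U) - Real.log (ρ' j U) - m U) - (Real.log (ρ j V) - Real.log (ρ' j V) - m V) - ((Real.log (ρ j W) - Real.log (ρ' j W) - m W) - (Real.log (ρ j Z) - Real.log (ρ' j Z) - m Z))| ≤ w' * Real.exp (-(κ * (b.src.tdist b'.src : ℝ))))

/-- VAR∘ · FIBRE VARIANCE (crux-row, rank 2 of this line; M–L).  JEN∘'s frame and hypotheses verbatim, plus a name `v` for the conditional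
χ-second moment `V ↦ E′_{χ,V}[h_{j+1}²]` (pinned by `∀ V, v V = …`, so the junction instantiates it by `rfl`); conclusion: the HALF CONDITIONAL VARIANCE
`q := ½(v − m²)` has 4-point weight `w′` at height `j`, same `κ`, with `Θ_j w′ ≤ C·x² + δ_j`.  Informal: `Δ_BΔ_{B′} Var′_{χ,V}[h]` is a finite sum of
conditional covariances `Cov′_{χ,V}(Δh_B-local, Δh_{B′}-local)` plus lower-order recentring terms; exponential clustering of the REFERENCE fibre measure
on the window (Brascamp–Lieb from the fibre-convexity height, or the one-measure cluster expansion) × the presentation `(c, a, w)` of `h` gives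
`w′ ≲ (a + Θw)²·const`, floor `δ_j` from the cutoff edge ∕ tails.  Why it might fail: clustering of the reference FIBRE measure (conditioned on `descend = V`,
cut by `χ`) is needed uniformly in `V` on the window and in the volume — the conditioning could spoil the convexity gap near the window's edge (the
R-CUT-χ margin `(24∕25)θ` is exactly where `log ρ′` is least concave); and the marginal part `β·a·Σc_p(1 − reTr)` of `h` contributes to the variance with a
VOLUME of terms whose covariances must be summed with the clustering weight (fine if `κ′ >` lattice growth rate, i.e. the class rate — the κ-ceiling).
Sources: Brascamp–Lieb (1976) Thm 4.1; [Balaban1985Propagators] (propagators∕covariances of the fluctuation measures); [Balaban1987RG1] §2;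
arXiv:2307.07619 §3.4 (Hessian of the renormalised potential = conditional variance); FL-17 column 1 (instr-1 j341016: reference response rate
`κ*_∞ = 1.224`, guidance only). -/
def FibreVarianceCan : Prop :=
  ∃ γ₁ : ℝ, 0 < γ₁ ∧ ∀ (F : T3Family) (γ : ℝ), 0 < γ → γ ≤ γ₁ → ∀ (b₀ p₀ : ℝ) (j₀ : ℕ) (prm : ℕ → ClassParams) (η : ℕ → ℝ), 0 < b₀ → 0 < p₀ → AdmissibleClassParams F γ b₀ p₀ prm → (∀ j, 0 ≤ η j) → Summable η → Summable (fun i => ∑' k, η (k + i)) → Tendsto (fun j => (∑' k, η (k + j)) * ((1 + 2 * ((F.L : ℝ) ^ j / γ) * (Fintype.card (Plaq (F.P j) 0) : ℝ)) * (Fintype.card (PBond (F.P j) 0) : ℝ) ^ 2)) atTop (𝓝 0) → ∃ κ₀ : ℝ, 0 < κ₀ ∧ ∀ (κ : ℝ), 0 < κ → κ ≤ κ₀ → ∃ θ₀ : ℝ, 0 < θ₀ ∧ ∀ (θ : ℝ), 0 < θ → θ ≤ θ₀ → ∃ (C w₀ : ℝ) (δ : ℕ → ℝ) (j₁ : ℕ),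 0 ≤ C ∧ 0 < w₀ ∧ (∀ j, 0 ≤ δ j) ∧ Summable δ ∧ Summable (fun i => ∑' k, δ (k + i)) ∧ Tendsto (fun j => (∑' k, δ (k + j)) * ((1 + 2 * ((F.L : ℝ) ^ j / γ) * (Fintype.card (Plaq (F.P j) 0) : ℝ)) * (Fintype.card (PBond (F.P j) 0) : ℝ) ^ 2)) atTop (𝓝 0) ∧ j₀ ≤ j₁ ∧ ∀ (ν : ℕ → (j : ℕ) → MeasureTheory.Measure (GaugeField (F.P j) 0 ↥(Matrix.specialUnitaryGroup (Fin 2) ℂ))), (∀ K, ν K K = T4GenFunBounds.gibbsMeasure (F.P K) ((F.scheme ℰp γ).β K)) → (∀ K j, j < K → ν K j = Measure.map (descend F ℰp j) (ν K (j + 1))) → ∀ (K K' : ℕ), K ≤ K' → ∀ (Ts T : ℕ), Ts < T → T ≤ K → ∀ (μ μ' : ((j : ℕ) → MeasureTheory.Measure (GaugeField (F.P j) 0 ↥(Matrix.specialUnitaryGroup (Fin 2) ℂ)))) (ρ ρ' : ((j : ℕ) → GaugeField (F.P j) 0 ↥(Matrix.specialUnitaryGroup (Fin 2) ℂ) → ℝ)),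 (∀ j : ℕ, Ts ≤ j → j ≤ T → μ j = ν K j ∧ μ' j = ν K' j) → (∀ j : ℕ, j < Ts → μ j = Measure.map (descend F ℰp j) ((μ (j + 1)).withDensity (fun U => ENNReal.ofReal (sfCut (θBal F.L γ b₀ p₀ (j + 1)) U))) ∧ μ' j = Measure.map (descend F ℰp j) ((μ' (j + 1)).withDensity (fun U => ENNReal.ofReal (sfCut (θBal F.L γ b₀ p₀ (j + 1)) U)))) → (∀ j : ℕ, Ts ≤ j → j < T → μ j = Measure.map (descend F ℰp j) (μ (j + 1)) ∧ μ' j = Measure.map (descend F ℰp j) (μ' (j + 1))) → (∀ j : ℕ, j ≤ T → IsFiniteMeasure (μ j) ∧ IsFiniteMeasure (μ' j)) → (∀ j : ℕ, j₀ ≤ j → j ≤ T → ((∀ U, PlaqSmall (θBal F.L γ b₀ p₀ j) U → 0 < ρ j U ∧ 0 < ρ' j U) ∧ μ j = (fieldMeasure _ _ _).withDensity (fun U => ENNReal.ofReal (ρ j U)) ∧ μ' j = (fieldMeasure _ _ _).withDensity (fun U => ENNReal.ofReal (ρ' j U)) ∧ (∃ κ : ℝ, MemAtHeight F ℰp j (prm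 j) (fun U => Real.exp κ * ρ j U)) ∧ (∃ κ : ℝ, MemAtHeight F ℰp j (prm j) (fun U => Real.exp κ * ρ' j U)) ∧ μ j {U | ¬ PlaqSmall (θBal F.L γ b₀ p₀ j) U} ≤ ENNReal.ofReal (η j) ∧ μ' j {U | ¬ PlaqSmall (θBal F.L γ b₀ p₀ j) U} ≤ ENNReal.ofReal (η j) ∧ (ContinuousOn (ρ j) {U | PlaqSmall (θBal F.L γ b₀ p₀ j) U} ∧ ContinuousOn (ρ' j) {U | PlaqSmall (θBal F.L γ b₀ p₀ j) U}))) → ∀ (j : ℕ), j₁ ≤ j → j + 2 ≤ T → j + 1 ≤ Ts → ∀ (σ : ProbabilityTheory.Kernel (GaugeField (F.P j) 0 ↥(Matrix.specialUnitaryGroup (Fin 2) ℂ)) (GaugeField (F.P (j + 1)) 0 ↥(Matrix.specialUnitaryGroup (Fin 2) ℂ))), ProbabilityTheory.IsMarkovKernel σ → (Measure.map (descend F ℰp j) (fieldMeasure (F.P (j + 1)) 0 ↥(Matrix.specialUnitaryGroup (Fin 2) ℂ))).bind ⇑σ = fieldMeasure (F.P (j + 1)) 0 ↥(Matrix.specialUnitaryGroup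 (Fin 2) ℂ) → (∀ᵐ V ∂(Measure.map (descend F ℰp j) (fieldMeasure (F.P (j + 1)) 0 ↥(Matrix.specialUnitaryGroup (Fin 2) ℂ))), ∀ᵐ U ∂(σ V), descend F ℰp j U = V) → ∀ (m : GaugeField (F.P j) 0 ↥(Matrix.specialUnitaryGroup (Fin 2) ℂ) → ℝ), ContinuousOn m {V | PlaqSmall (θBal F.L γ b₀ p₀ j) V} → (∀ᵐ V ∂(fieldMeasure (F.P j) 0 ↥(Matrix.specialUnitaryGroup (Fin 2) ℂ)), PlaqSmall (θBal F.L γ b₀ p₀ j) V → MeasureTheory.Integrable (fun U => sfCut (θBal F.L γ b₀ p₀ (j + 1)) U * (Real.log (ρ (j + 1) U) - Real.log (ρ' (j + 1) U)) * ρ' (j + 1) U) (σ V) ∧ m V = (∫ U, sfCut (θBal F.L γ b₀ p₀ (j + 1)) U * (Real.log (ρ (j + 1) U) - Real.log (ρ' (j + 1) U)) * ρ' (j + 1) U ∂(σ V)) / (∫ U, sfCut (θBal F.L γ b₀ p₀ (j + 1)) U * ρ' (j + 1) U ∂(σ V))) → ∀ (v : GaugeField (F.P j) 0 ↥(Matrix.specialUnitaryGroup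 (Fin 2) ℂ) → ℝ), (∀ V, v V = (∫ U, sfCut (θBal F.L γ b₀ p₀ (j + 1)) U * (Real.log (ρ (j + 1) U) - Real.log (ρ' (j + 1) U)) ^ 2 * ρ' (j + 1) U ∂(σ V)) / (∫ U, sfCut (θBal F.L γ b₀ p₀ (j + 1)) U * ρ' (j + 1) U ∂(σ V))) → ∀ (c : Plaq (F.P (j + 1)) 0 → ℝ) (a w : ℝ), 0 ≤ a → 0 ≤ w → a + θ / (((F.L : ℝ) ^ (j + 1) / γ) * θBal F.L γ b₀ p₀ (j + 1) ^ 2) * w ≤ w₀ → ((∀ p, |c p| ≤ a) ∧ (∀ (b b' : PBond (F.P (j + 1)) 0) U V W Z, PlaqSmall (θBal F.L γ b₀ p₀ (j + 1)) U → PlaqSmall (θBal F.L γ b₀ p₀ (j + 1)) V → PlaqSmall (θBal F.L γ b₀ p₀ (j + 1)) W → PlaqSmall (θBal F.L γ b₀ p₀ (j + 1)) Z → (∀ e, e ≠ b → U e = V e) → (∀ e, e ≠ b' → U e = W e) → (∀ e, e ≠ b' → V e = Z e) → (∀ e, e ≠ b → W e = Z e) → |(Real.log (ρ (j + 1) U)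 - Real.log (ρ' (j + 1) U) - ((F.L : ℝ) ^ (j + 1) / γ) * ∑ p, c p * (1 - reTr (GaugeField.plaqHol U p))) - (Real.log (ρ (j + 1) V) - Real.log (ρ' (j + 1) V) - ((F.L : ℝ) ^ (j + 1) / γ) * ∑ p, c p * (1 - reTr (GaugeField.plaqHol V p))) - ((Real.log (ρ (j + 1) W) - Real.log (ρ' (j + 1) W) - ((F.L : ℝ) ^ (j + 1) / γ) * ∑ p, c p * (1 - reTr (GaugeField.plaqHol W p))) - (Real.log (ρ (j + 1) Z) - Real.log (ρ' (j + 1) Z) - ((F.L : ℝ) ^ (j + 1) / γ) * ∑ p, c p * (1 - reTr (GaugeField.plaqHol Z p))))| ≤ w * Real.exp (-(κ * (b.src.tdist b'.src : ℝ))))) → ∃ (w' : ℝ), 0 ≤ w' ∧ θ / (((F.L : ℝ) ^ j / γ) * θBal F.L γ b₀ p₀ j ^ 2) * w' ≤ C * (a + θ / (((F.L : ℝ) ^ (j + 1) / γ) * θBal F.L γ b₀ p₀ (j + 1) ^ 2) * w) * (a + θ / (((F.L : ℝ) ^ (j + 1) / γ) * θBal F.L γ b₀ p₀ (j + 1) ^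 2) * w) + δ j ∧ (∀ (b b' : PBond (F.P j) 0) U V W Z, PlaqSmall (θBal F.L γ b₀ p₀ j) U → PlaqSmall (θBal F.L γ b₀ p₀ j) V → PlaqSmall (θBal F.L γ b₀ p₀ j) W → PlaqSmall (θBal F.L γ b₀ p₀ j) Z → (∀ e, e ≠ b → U e = V e) → (∀ e, e ≠ b' → U e = W e) → (∀ e, e ≠ b' → V e = Z e) → (∀ e, e ≠ b → W e = Z e) → |(1 / 2 * (v U - m U ^ 2)) - (1 / 2 * (v V - m V ^ 2)) - ((1 / 2 * (v W - m W ^ 2)) - (1 / 2 * (v Z - m Z ^ 2)))| ≤ w' * Real.exp (-(κ * (b.src.tdist b'.src : ℝ))))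

/-- LME3∘ · CUMULANT REMAINDER (crux-row, rank 3 of this line; M).  Same frame; conclusion: the CUMULANT TAIL `g − q = log E′_{χ,V}[e^h] − E′[h] − ½Var′[h]
= Σ_{n≥3} κ_n∕n!` has 4-point weight `w′` at height `j` with `Θ_j w′ ≤ C·x² + δ_j` (in truth third order in `x`).  Informal: the Brydges–Kennedy ∕ BKAR
tree-graph bound for the connected parts of `E′_{χ,V}[e^{h}]` with `h` a sum of exponentially clustered local terms of total local size `≲ x ≤ w₀`: the
series of cumulants of order ≥ 3 converges and its 4-point second differences inherit the clustering weight.  Why it might fail: convergence needs the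
LOCAL size of `h` small in the fibre measure's natural norm — the marginal part `β·Σ c_p(1 − reTr U_p)` has local size `β·a·θ²_{j+1} ≍ a·p²` per
plaquette, which is small only because `a ≤ w₀` (fine) but sums over the `κ`-ball of the clustering weight with the lattice growth rate (the κ-ceiling
again); and the cut `χ` is only Lipschitz (R-CUT-χ), so cumulants of `h` against `χρ′dσ_V` see the cutoff's edge — floor `δ_j`.  Sources: D. Brydges,
«A short course on cluster expansions» (Les Houches 1984) §§2–3; Brydges–Kennedy, J. Stat. Phys. 48 (1987) 19 (tree-graph bound); [Balaban1987RG1] §2;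
[Balaban1988RG2] §1; M. Salmhofer, «Renormalization» (1999) §2.4 (cumulant∕polymer expansions). -/
def CumulantRemainderCan : Prop :=
  ∃ γ₁ : ℝ, 0 < γ₁ ∧ ∀ (F : T3Family) (γ : ℝ), 0 < γ → γ ≤ γ₁ → ∀ (b₀ p₀ : ℝ) (j₀ : ℕ) (prm : ℕ → ClassParams) (η : ℕ → ℝ), 0 < b₀ → 0 < p₀ → AdmissibleClassParams F γ b₀ p₀ prm → (∀ j, 0 ≤ η j) → Summable η → Summable (fun i => ∑' k, η (k + i)) → Tendsto (fun j => (∑' k, η (k + j)) * ((1 + 2 * ((F.L : ℝ) ^ j / γ) * (Fintype.card (Plaq (F.P j) 0) : ℝ)) * (Fintype.card (PBond (F.P j) 0) : ℝ) ^ 2)) atTop (𝓝 0) → ∃ κ₀ : ℝ, 0 < κ₀ ∧ ∀ (κ : ℝ), 0 < κ → κ ≤ κ₀ → ∃ θ₀ : ℝ, 0 < θ₀ ∧ ∀ (θ : ℝ), 0 < θ → θ ≤ θ₀ → ∃ (C w₀ : ℝ) (δ : ℕ → ℝ) (j₁ : ℕ), 0 ≤ C ∧ 0 < w₀ ∧ (∀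 j, 0 ≤ δ j) ∧ Summable δ ∧ Summable (fun i => ∑' k, δ (k + i)) ∧ Tendsto (fun j => (∑' k, δ (k + j)) * ((1 + 2 * ((F.L : ℝ) ^ j / γ) * (Fintype.card (Plaq (F.P j) 0) : ℝ)) * (Fintype.card (PBond (F.P j) 0) : ℝ) ^ 2)) atTop (𝓝 0) ∧ j₀ ≤ j₁ ∧ ∀ (ν : ℕ → (j : ℕ) → MeasureTheory.Measure (GaugeField (F.P j) 0 ↥(Matrix.specialUnitaryGroup (Fin 2) ℂ))), (∀ K, ν K K = T4GenFunBounds.gibbsMeasure (F.P K) ((F.scheme ℰp γ).β K)) → (∀ K j, j < K → ν K j = Measure.map (descend F ℰp j) (ν K (j + 1))) → ∀ (K K' : ℕ), K ≤ K' → ∀ (Ts T : ℕ), Ts < T → T ≤ K → ∀ (μ μ' : ((j : ℕ) → MeasureTheory.Measure (GaugeField (F.P j) 0 ↥(Matrix.specialUnitaryGroup (Fin 2) ℂ)))) (ρ ρ' : ((j : ℕ) → GaugeField (F.P j) 0 ↥(Matrix.specialUnitaryGroup (Fin 2) ℂ) → ℝ)), (∀ j : ℕ, Ts ≤ j → j ≤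 T → μ j = ν K j ∧ μ' j = ν K' j) → (∀ j : ℕ, j < Ts → μ j = Measure.map (descend F ℰp j) ((μ (j + 1)).withDensity (fun U => ENNReal.ofReal (sfCut (θBal F.L γ b₀ p₀ (j + 1)) U))) ∧ μ' j = Measure.map (descend F ℰp j) ((μ' (j + 1)).withDensity (fun U => ENNReal.ofReal (sfCut (θBal F.L γ b₀ p₀ (j + 1)) U)))) → (∀ j : ℕ, Ts ≤ j → j < T → μ j = Measure.map (descend F ℰp j) (μ (j + 1)) ∧ μ' j = Measure.map (descend F ℰp j) (μ' (j + 1))) → (∀ j : ℕ, j ≤ T → IsFiniteMeasure (μ j) ∧ IsFiniteMeasure (μ' j)) → (∀ j : ℕ, j₀ ≤ j → j ≤ T → ((∀ U, PlaqSmall (θBal F.L γ b₀ p₀ j) U → 0 < ρ j U ∧ 0 < ρ' j U) ∧ μ j = (fieldMeasure _ _ _).withDensity (fun U => ENNReal.ofReal (ρ j U)) ∧ μ' j = (fieldMeasure _ _ _).withDensity (fun U => ENNReal.ofReal (ρ' j U)) ∧ (∃ κ : ℝ, MemAtHeight F ℰp j (prm j) (fun U => Real.exp κ * ρ j U)) ∧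 (∃ κ : ℝ, MemAtHeight F ℰp j (prm j) (fun U => Real.exp κ * ρ' j U)) ∧ μ j {U | ¬ PlaqSmall (θBal F.L γ b₀ p₀ j) U} ≤ ENNReal.ofReal (η j) ∧ μ' j {U | ¬ PlaqSmall (θBal F.L γ b₀ p₀ j) U} ≤ ENNReal.ofReal (η j) ∧ (ContinuousOn (ρ j) {U | PlaqSmall (θBal F.L γ b₀ p₀ j) U} ∧ ContinuousOn (ρ' j) {U | PlaqSmall (θBal F.L γ b₀ p₀ j) U}))) → ∀ (j : ℕ), j₁ ≤ j → j + 2 ≤ T → j + 1 ≤ Ts → ∀ (σ : ProbabilityTheory.Kernel (GaugeField (F.P j) 0 ↥(Matrix.specialUnitaryGroup (Fin 2) ℂ)) (GaugeField (F.P (j + 1)) 0 ↥(Matrix.specialUnitaryGroup (Fin 2) ℂ))), ProbabilityTheory.IsMarkovKernel σ → (Measure.map (descend F ℰp j) (fieldMeasure (F.P (j + 1)) 0 ↥(Matrix.specialUnitaryGroup (Fin 2) ℂ))).bind ⇑σ = fieldMeasure (F.P (j + 1)) 0 ↥(Matrix.specialUnitaryGroup (Fin 2) ℂ) → (∀ᵐ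 V ∂(Measure.map (descend F ℰp j) (fieldMeasure (F.P (j + 1)) 0 ↥(Matrix.specialUnitaryGroup (Fin 2) ℂ))), ∀ᵐ U ∂(σ V), descend F ℰp j U = V) → ∀ (m : GaugeField (F.P j) 0 ↥(Matrix.specialUnitaryGroup (Fin 2) ℂ) → ℝ), ContinuousOn m {V | PlaqSmall (θBal F.L γ b₀ p₀ j) V} → (∀ᵐ V ∂(fieldMeasure (F.P j) 0 ↥(Matrix.specialUnitaryGroup (Fin 2) ℂ)), PlaqSmall (θBal F.L γ b₀ p₀ j) V → MeasureTheory.Integrable (fun U => sfCut (θBal F.L γ b₀ p₀ (j + 1)) U * (Real.log (ρ (j + 1) U) - Real.log (ρ' (j + 1) U)) * ρ' (j + 1) U) (σ V) ∧ m V = (∫ U, sfCut (θBal F.L γ b₀ p₀ (j + 1)) U * (Real.log (ρ (j + 1) U) - Real.log (ρ' (j + 1) U)) * ρ' (j + 1) U ∂(σ V)) / (∫ U, sfCut (θBal F.L γ b₀ p₀ (j + 1)) U * ρ' (j + 1) U ∂(σ V))) → ∀ (v : GaugeField (F.P j) 0 ↥(Matrix.specialUnitaryGroup (Fin 2) ℂ)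 → ℝ), (∀ V, v V = (∫ U, sfCut (θBal F.L γ b₀ p₀ (j + 1)) U * (Real.log (ρ (j + 1) U) - Real.log (ρ' (j + 1) U)) ^ 2 * ρ' (j + 1) U ∂(σ V)) / (∫ U, sfCut (θBal F.L γ b₀ p₀ (j + 1)) U * ρ' (j + 1) U ∂(σ V))) → ∀ (c : Plaq (F.P (j + 1)) 0 → ℝ) (a w : ℝ), 0 ≤ a → 0 ≤ w → a + θ / (((F.L : ℝ) ^ (j + 1) / γ) * θBal F.L γ b₀ p₀ (j + 1) ^ 2) * w ≤ w₀ → ((∀ p, |c p| ≤ a) ∧ (∀ (b b' : PBond (F.P (j + 1)) 0) U V W Z, PlaqSmall (θBal F.L γ b₀ p₀ (j + 1)) U → PlaqSmall (θBal F.L γ b₀ p₀ (j + 1)) V → PlaqSmall (θBal F.L γ b₀ p₀ (j + 1)) W → PlaqSmall (θBal F.L γ b₀ p₀ (j + 1)) Z → (∀ e, e ≠ b → U e = V e) → (∀ e, e ≠ b' → U e = W e) → (∀ e, e ≠ b' → V e = Z e) → (∀ e, e ≠ b → W e = Z e) → |(Real.log (ρ (j + 1) U) - Real.log (ρ' (j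 + 1) U) - ((F.L : ℝ) ^ (j + 1) / γ) * ∑ p, c p * (1 - reTr (GaugeField.plaqHol U p))) - (Real.log (ρ (j + 1) V) - Real.log (ρ' (j + 1) V) - ((F.L : ℝ) ^ (j + 1) / γ) * ∑ p, c p * (1 - reTr (GaugeField.plaqHol V p))) - ((Real.log (ρ (j + 1) W) - Real.log (ρ' (j + 1) W) - ((F.L : ℝ) ^ (j + 1) / γ) * ∑ p, c p * (1 - reTr (GaugeField.plaqHol W p))) - (Real.log (ρ (j + 1) Z) - Real.log (ρ' (j + 1) Z) - ((F.L : ℝ) ^ (j + 1) / γ) * ∑ p, c p * (1 - reTr (GaugeField.plaqHol Z p))))| ≤ w * Real.exp (-(κ * (b.src.tdist b'.src : ℝ))))) → ∃ (w' : ℝ), 0 ≤ w' ∧ θ / (((F.L : ℝ) ^ j / γ) * θBal F.L γ b₀ p₀ j ^ 2) * w' ≤ C * (a + θ / (((F.L : ℝ) ^ (j + 1) / γ) * θBal F.L γ b₀ p₀ (j + 1) ^ 2) * w) * (a + θ / (((F.L : ℝ) ^ (j + 1) / γ) * θBal F.L γ b₀ p₀ (j + 1) ^ 2) * w) + δ j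 ∧ (∀ (b b' : PBond (F.P j) 0) U V W Z, PlaqSmall (θBal F.L γ b₀ p₀ j) U → PlaqSmall (θBal F.L γ b₀ p₀ j) V → PlaqSmall (θBal F.L γ b₀ p₀ j) W → PlaqSmall (θBal F.L γ b₀ p₀ j) Z → (∀ e, e ≠ b → U e = V e) → (∀ e, e ≠ b' → U e = W e) → (∀ e, e ≠ b' → V e = Z e) → (∀ e, e ≠ b → W e = Z e) → |(Real.log (ρ j U) - Real.log (ρ' j U) - m U - 1 / 2 * (v U - m U ^ 2)) - (Real.log (ρ j V) - Real.log (ρ' j V) - m V - 1 / 2 * (v V - m V ^ 2)) - ((Real.log (ρ j W) - Real.log (ρ' j W) - m W - 1 / 2 * (v W - m W ^ 2)) - (Real.log (ρ j Z) - Real.log (ρ' j Z) - m Z - 1 / 2 * (v Z - m Z ^ 2)))| ≤ w' * Real.exp (-(κ * (b.src.tdist b'.src : ℝ))))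

/-- stub (VAR∘). -/
theorem stub_fibreVariance : FibreVarianceCan := by
  sorry

/-- stub (LME3∘). -/
theorem stub_cumulantRemainder : CumulantRemainderCan := by
  sorry

/-- ★C1 JUNCTION (kernel-checked, no sorry): second-order truncation of the cumulant generating function re-assembles the Jensen gap.
`g = q + (g − q)` pointwise; `v :=` the explicit conditional second moment (hypothesis discharged by `rfl`); `w′ := w′_q + w′_r` (the 4-point second
difference is linear, `|·|` subadditive); `γ₁, κ₀, θ₀, w₀` by `min`, `j₁` by `max`, `C := C₁ + C₂`, `δ := δ₁ + δ₂` (floor class closed under `+`). -/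
theorem jensenGap_of_cumulantCut (hA : FibreVarianceCan) (hB : CumulantRemainderCan) : JensenGapCan := by
  obtain ⟨γA, hγA, hA⟩ := hA
  obtain ⟨γB, hγB, hB⟩ := hB
  refine ⟨min γA γB, lt_min hγA hγB, ?_⟩
  intro F γ hγ hγ1 b₀ p₀ j₀ prm η hb₀ hp₀ hadm hη0 hηs hηss hηt
  obtain ⟨κA, hκA, hA⟩ := hA F γ hγ (hγ1.trans (min_le_left _ _)) b₀ p₀ j₀ prm η hb₀ hp₀ hadm hη0 hηs hηss hηt
  obtain ⟨κB, hκB, hB⟩ := hB F γ hγ (hγ1.trans (min_le_right _ _)) b₀ p₀ j₀ prm η hb₀ hp₀ hadm hη0 hηs hηss hηt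
  refine ⟨min κA κB, lt_min hκA hκB, ?_⟩
  intro κ hκ hκle
  obtain ⟨θA, hθA, hA⟩ := hA κ hκ (hκle.trans (min_le_left _ _))
  obtain ⟨θB, hθB, hB⟩ := hB κ hκ (hκle.trans (min_le_right _ _))
  refine ⟨min θA θB, lt_min hθA hθB, ?_⟩
  intro θ hθ hθle
  obtain ⟨CA, wA, δA, jA, hCA, hwA, hnnA, hδAs, hδAss, hδAt, hjA, hA⟩ := hA θ hθ (hθle.trans (min_le_left _ _))
  obtain ⟨CB, wB, δB, jB, hCB, hwB, hnnB, hδBs, hδBss, hδBt, hjB, hB⟩ := hB θ hθ (hθle.trans (min_le_right _ _))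
  have h1 : ∀ i, Summable (fun k => δA (k + i)) := fun i => (summable_nat_add_iff i).mpr hδAs
  have h2 : ∀ i, Summable (fun k => δB (k + i)) := fun i => (summable_nat_add_iff i).mpr hδBs
  refine ⟨CA + CB, min wA wB, fun j => δA j + δB j, max jA jB, add_nonneg hCA hCB, lt_min hwA hwB,
    fun j => add_nonneg (hnnA j) (hnnB j), hδAs.add hδBs, ?_, ?_, hjA.trans (le_max_left _ _), ?_⟩
  · have key : (fun i => ∑' k, (δA (k + i) + δB (k + i))) =
        fun i => (∑' k, δA (k + i)) + ∑' k, δB (k + i) := by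
      funext i
      exact (h1 i).tsum_add (h2 i)
    rw [key]
    exact hδAss.add hδBss
  · have key : (fun j => (∑' k, (δA (k + j) + δB (k + j))) * ((1 + 2 * ((F.L : ℝ) ^ j / γ) * (Fintype.card (Plaq (F.P j) 0) : ℝ)) * (Fintype.card (PBond (F.P j) 0) : ℝ) ^ 2)) =
        fun j => (∑' k, δA (k + j)) * ((1 + 2 * ((F.L : ℝ) ^ j / γ) * (Fintype.card (Plaq (F.P j) 0) : ℝ)) * (Fintype.card (PBond (F.P j) 0) : ℝ) ^ 2) +
          (∑' k, δB (k + j)) * ((1 + 2 * ((F.L : ℝ) ^ j / γ) * (Fintype.card (Plaq (F.P j) 0) : ℝ)) * (Fintype.card (PBond (F.P j) 0) : ℝ) ^ 2) := by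
      funext j
      rw [(h1 j).tsum_add (h2 j), add_mul]
    rw [key]
    simpa using hδAt.add hδBt
  · intro ν hG hCν K K' hKK' Ts T hTs hTK μ μ' ρ ρ' hanch hcut hcons hfin hwin j hj hjT hjTs σ hσM hσb hσf m hmc hmae c a w ha hw hx hin
    have hv : ∀ V, (fun V => (∫ U, sfCut (θBal F.L γ b₀ p₀ (j + 1)) U * (Real.log (ρ (j + 1) U) - Real.log (ρ' (j + 1) U)) ^ 2 * ρ' (j + 1) U ∂(σ V)) / (∫ U, sfCut (θBal F.L γ b₀ p₀ (j + 1)) U * ρ' (j + 1) U ∂(σ V))) V = (∫ U, sfCut (θBal F.L γ b₀ p₀ (j + 1)) U * (Real.log (ρ (j + 1) U) - Real.log (ρ' (j + 1) U)) ^ 2 * ρ' (j + 1) U ∂(σ V)) / (∫ U, sfCut (θBal F.L γ b₀ p₀ (j + 1)) U * ρ' (j + 1) U ∂(σ V)) :=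
      fun V => rfl
    obtain ⟨w₁, hw₁, hbdA, h4A⟩ :=
      hA ν hG hCν K K' hKK' Ts T hTs hTK μ μ' ρ ρ' hanch hcut hcons hfin hwin j ((le_max_left jA jB).trans hj) hjT hjTs σ hσM hσb hσf m hmc hmae
        (fun V => (∫ U, sfCut (θBal F.L γ b₀ p₀ (j + 1)) U * (Real.log (ρ (j + 1) U) - Real.log (ρ' (j + 1) U)) ^ 2 * ρ' (j + 1) U ∂(σ V)) / (∫ U, sfCut (θBal F.L γ b₀ p₀ (j + 1)) U * ρ' (j + 1) U ∂(σ V))) hv c a w ha hw (hx.trans (min_le_left _ _)) hin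
    obtain ⟨w₂, hw₂, hbdB, h4B⟩ :=
      hB ν hG hCν K K' hKK' Ts T hTs hTK μ μ' ρ ρ' hanch hcut hcons hfin hwin j ((le_max_right jA jB).trans hj) hjT hjTs σ hσM hσb hσf m hmc hmae
        (fun V => (∫ U, sfCut (θBal F.L γ b₀ p₀ (j + 1)) U * (Real.log (ρ (j + 1) U) - Real.log (ρ' (j + 1) U)) ^ 2 * ρ' (j + 1) U ∂(σ V)) / (∫ U, sfCut (θBal F.L γ b₀ p₀ (j + 1)) U * ρ' (j + 1) U ∂(σ V))) hv c a w ha hw (hx.trans (min_le_right _ _)) hin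
    refine ⟨w₁ + w₂, add_nonneg hw₁ hw₂, ?_, ?_⟩
    · linear_combination hbdA + hbdB
    · intro b b' U V W Z hU hV' hW hZ e1 e2 e3 e4
      have A := h4A b b' U V W Z hU hV' hW hZ e1 e2 e3 e4
      have B := h4B b b' U V W Z hU hV' hW hZ e1 e2 e3 e4
      have hsum := add_le_add A B
      rw [← add_mul] at hsum
      refine le_trans ?_ hsum
      refine le_trans (le_of_eq ?_) (abs_add_le _ _)
      congr 1
      ring

/-- ★ JUNCTION of organ_tangent (g25-1 v2; re-proved here verbatim so that this file stands alone): VER∘ → LIN∘ → JEN∘ → O1.  The Taylor split re-assembles the organ.  `h_j = m + (h_j − m)` pointwise on the window,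
`c′ := c′_lin`, `a′ := a′_lin`, `w′ := w′_lin + w′_q` (4-point subadditivity), `γ₁ := min γ₁ᴸ γ₁ᴶ 1` (VER∘ v2.3 lives in `γ ≤ 1`), `κ₀ := min κ₀ᴸ κ₀ᴶ`, `θ := min θ₀ᴸ θ₀ᴶ`, `w₀ := min`, `j₁ := max jL jJ jV`,
`δ := δᴸ + δᴶ` (floor class closed under `+`), and `((1 + ε + εd)·x + δᴸ) + (C·x·x + δᴶ) = (1 + ε + εd + C·x)·x + δ`. -/
theorem oneStepContractionRun_of_tangentCut
    (hV : FibreMeanVersionCan) (hL : TangentTransportCan) (hJ : JensenGapCan) :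
    OneStepContractionRun := by
  obtain ⟨γL, hγL, hL⟩ := hL
  obtain ⟨γJ, hγJ, hJ⟩ := hJ
  refine ⟨min (min γL γJ) 1, lt_min (lt_min hγL hγJ) one_pos, ?_⟩
  intro F γ hγ hγ1 b₀ p₀ j₀ prm η hb₀ hp₀ hadm hη0 hηs hηss hηt
  have hγone : γ ≤ 1 := hγ1.trans (min_le_right _ _)
  obtain ⟨jV, hV⟩ := hV F γ b₀ p₀ hγ hγone hb₀ hp₀
  obtain ⟨κL, hκL, hL⟩ := hL F γ hγ (hγ1.trans ((min_le_left _ _).trans (min_le_left _ _))) b₀ p₀ j₀ prm η hb₀ hp₀ hadm hη0 hηs hηss hηt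
  obtain ⟨κJ, hκJ, hJ⟩ := hJ F γ hγ (hγ1.trans ((min_le_left _ _).trans (min_le_right _ _))) b₀ p₀ j₀ prm η hb₀ hp₀ hadm hη0 hηs hηss hηt
  refine ⟨min κL κJ, lt_min hκL hκJ, ?_⟩
  intro κ hκ hκle
  obtain ⟨θL, hθL, hL⟩ := hL κ hκ (hκle.trans (min_le_left _ _))
  obtain ⟨θJ, hθJ, hJ⟩ := hJ κ hκ (hκle.trans (min_le_right _ _))
  obtain ⟨wL, ε, εd, δL, jL, hwL, hnnL, hεs, hεds, hδLs, hδLss, hδLt, hjL, hL⟩ :=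
    hL (min θL θJ) (lt_min hθL hθJ) (min_le_left _ _)
  obtain ⟨C, wJ, δJ, jJ, hC, hwJ, hnnJ, hδJs, hδJss, hδJt, hjJ, hJ⟩ :=
    hJ (min θL θJ) (lt_min hθL hθJ) (min_le_right _ _)
  have h1 : ∀ i, Summable (fun k => δL (k + i)) := fun i => (summable_nat_add_iff i).mpr hδLs
  have h2 : ∀ i, Summable (fun k => δJ (k + i)) := fun i => (summable_nat_add_iff i).mpr hδJs
  refine ⟨min θL θJ, C, min wL wJ, ε, εd, fun j => δL j + δJ j, max (max jL jJ) jV, lt_min hθL hθJ, hC, lt_min hwL hwJ, ?_,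
    hεs, hεds, hδLs.add hδJs, ?_, ?_, hjL.trans ((le_max_left jL jJ).trans (le_max_left (max jL jJ) jV)), ?_⟩
  · intro j
    exact ⟨(hnnL j).1, (hnnL j).2.1, add_nonneg (hnnL j).2.2 (hnnJ j)⟩
  · have key : (fun i => ∑' k, (δL (k + i) + δJ (k + i))) =
        fun i => (∑' k, δL (k + i)) + ∑' k, δJ (k + i) := by
      funext i
      exact (h1 i).tsum_add (h2 i)
    rw [key]
    exact hδLss.add hδJss
  · have key : (fun j => (∑' k, (δL (k + j) + δJ (k + j))) * ((1 + 2 * ((F.L : ℝ) ^ j / γ) * (Fintype.card (Plaq (F.P j) 0) : ℝ)) * (Fintype.card (PBond (F.P j) 0) : ℝ) ^ 2)) =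
        fun j => (∑' k, δL (k + j)) * ((1 + 2 * ((F.L : ℝ) ^ j / γ) * (Fintype.card (Plaq (F.P j) 0) : ℝ)) * (Fintype.card (PBond (F.P j) 0) : ℝ) ^ 2) +
          (∑' k, δJ (k + j)) * ((1 + 2 * ((F.L : ℝ) ^ j / γ) * (Fintype.card (Plaq (F.P j) 0) : ℝ)) * (Fintype.card (PBond (F.P j) 0) : ℝ) ^ 2) := by
      funext j
      rw [(h1 j).tsum_add (h2 j), add_mul]
    rw [key]
    simpa using hδLt.add hδJt
  · intro ν hG hCν K K' hKK' Ts T hTs hTK μ μ' ρ ρ' hanch hcut hcons hfin hwin j hj hjT hjTs c a w ha hw hx hin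
    obtain ⟨σ, hσM, hσb, hσf⟩ :=
      Summit.QuantumFields.YangMills.Theorems.BackwardLiouvilleRigidity.FibreLaplace.stub_descentDisintegration F j
    have hjLJ : max jL jJ ≤ j := (le_max_left (max jL jJ) jV).trans hj
    have hj₀ : j₀ ≤ j := hjL.trans ((le_max_left jL jJ).trans hjLJ)
    have hjT' : j + 1 ≤ T := by omega
    obtain ⟨m, hmc, hmae⟩ :=
      hV j₀ prm η ν hG hCν K K' hKK' Ts T hTs hTK μ μ' ρ ρ' hanch hcut hcons hfin hwin j ((le_max_right (max jL jJ) jV).trans hj) hj₀ hjT' σ hσM hσb hσf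
    obtain ⟨c', a', w₁, ha', hw₁, hbdL, hc', h4L⟩ :=
      hL ν hG hCν K K' hKK' Ts T hTs hTK μ μ' ρ ρ' hanch hcut hcons hfin hwin j ((le_max_left jL jJ).trans hjLJ) hjT hjTs σ hσM hσb hσf m hmc hmae c a w ha hw
        (hx.trans (min_le_left _ _)) hin
    obtain ⟨w₂, hw₂, hbdJ, h4J⟩ :=
      hJ ν hG hCν K K' hKK' Ts T hTs hTK μ μ' ρ ρ' hanch hcut hcons hfin hwin j ((le_max_right jL jJ).trans hjLJ) hjT hjTs σ hσM hσb hσf m hmc hmae c a w ha hw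
        (hx.trans (min_le_right _ _)) hin
    refine ⟨c', a', w₁ + w₂, ha', add_nonneg hw₁ hw₂, ?_, hc', ?_⟩
    · linear_combination hbdL + hbdJ
    · intro b b' U V W Z hU hV' hW hZ e1 e2 e3 e4
      have A := h4L b b' U V W Z hU hV' hW hZ e1 e2 e3 e4
      have B := h4J b b' U V W Z hU hV' hW hZ e1 e2 e3 e4
      have hsum := add_le_add A B
      rw [← add_mul] at hsum
      refine le_trans ?_ hsum
      refine le_trans (le_of_eq ?_) (abs_add_le _ _)
      congr 1
      ring

/-- ★C2 JUNCTION (kernel-checked, no sorry): VER∘ → LIN∘ → VAR∘ → LME3∘ → O1 := ★ ∘ ★C1. -/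
theorem oneStepContractionRun_of_cumulantCut
    (hV : FibreMeanVersionCan) (hL : TangentTransportCan) (hA : FibreVarianceCan) (hB : CumulantRemainderCan) :
    OneStepContractionRun :=
  oneStepContractionRun_of_tangentCut hV hL (jensenGap_of_cumulantCut hA hB)

/-- The line's composition from its stubs (2 sorries upstream; VER∘∕LIN∘ taken as hypotheses — their stubs live in organ_tangent.lean). -/
theorem jensenGap_of_stubs : JensenGapCan :=
  jensenGap_of_cumulantCut stub_fibreVariance stub_cumulantRemainder

end Summit.QuantumFields.YangMills.Cruxes.FluctuationComparisonRegPrIntL.JensenCumulant
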